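import Mathlib.RingTheory.KrullDimension.Regular
import Literature.RingTheory.TightClosure.RegularTightlyClosed
import Literature.AlgebraicGeometry.Resolution.CohenMacaulayCatenary
import Summits.ResolutionOfSingularities.ResolutionOfSingularities.Theorems.FrobeniusLadderFRationalModificationSopWeaklyRegular
import HarnessLib

/-!
# Fedder's criterion for hypersurfaces, sufficiency, in Frobenius-closure form (no F-finiteness)

Support file for crux stmt-ResolutionOfSingularities-15315 (`FrobeniusLadder.FInjectiveMacaulayfication`,
line `Sketch`): the certification engine E2 of the lead's notes. Let `(R, 𝔪)` be a regular local ring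
of prime characteristic `p` and `f ∈ R` with **Fedder's condition** `f^(p-1) ∉ 𝔪^[p]`. Then

* `mem_sup_span_of_pow_mem` — for every ideal `J` and every `y`, `y^p ∈ J^[p] + (f)` forces
  `y ∈ J + (f)` (multiply by `f^(p-1)` to land in `(J + (f))^[p]`, apply Kunz's flat colon
  `I^[p] : y^p ⊆ (I : y)^[p]` — in tree, `mem_frobeniusPower_colon_of_isRegularLocalRing` — and read off
  `f^(p-1) ∈ (I : y)^[p] ⊆ 𝔪^[p]` unless `y ∈ I`);
* `mem_sup_span_of_pow_pow_mem` — the same with `p^e` (induction on `e`, applying the `p`-step to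
  `J^[p^e]`);
* `frobeniusClosed_quotient` — **every ideal of the hypersurface ring `R/(f)` is Frobenius closed**,
  in the inline form of the crux's clause;
* `sop_isWeaklyRegular_quotient` — every system of parameters of `R/(f)` (`f ∈ 𝔪`, `f ≠ 0`) is a weakly
  regular sequence (regular ⇒ Cohen–Macaulay, cut down by the non-zero-divisor `f`, Matsumura 17.4 (iii));
* `fedder_hypersurface_clause` — both halves with every binder explicit (the registered helper stub):
  the local ring of a hypersurface `{f = 0}` in a regular ambient satisfies the per-stalk clause of crux
  `FInjectiveMacaulayfication` (all s.o.p. weakly regular, all parameter ideals — indeed all ideals —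
  Frobenius closed) as soon as `f^(p-1) ∉ 𝔪^[p]`.

This is the direction "⇐" of Fedder's F-purity criterion [Fedder1983, Prop. 1.7 / Thm. 1.12] for
hypersurfaces, weakened from "F-pure" to "all ideals Frobenius closed" — which is exactly what the crux
consumes — and thereby freed of the F-finiteness hypothesis: only Kunz's theorem (flatness of Frobenius on
a regular local ring) is used. It is the first lemma `FedderHypersurfaceCMFI` of crux card
`fedder-embedded-f-purification` and the pointwise test behind the toy computations of cards
`graded-cartier-criterion` / `cartier-contraction-centres` / `weighted-cone-deformation-descent`.

References: [Fedder1983] R. Fedder, F-purity and rational singularity, Trans. AMS 278 (1983), Prop. 1.7,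
Thm. 1.12; [HunekeSwanson2006] Thm. 13.1.2 (6) and its proof (Kunz's colon identity);
[Matsumura1987] Thm. 17.4 (iii), 17.8.
-/

-- single-problem summit: the doubled namespace component `ResolutionOfSingularities` is forced
set_option linter.dupNamespace false

namespace Summit.ResolutionOfSingularities.ResolutionOfSingularities.Theorems.FInjectiveMacaulayfication.Fedder

open IsLocalRing RingTheory.Sequence Literature.RingTheory.TightClosure
  Literature.AlgebraicGeometry.Resolution

variable {R : Type*} [CommRing R]

/-! ## §1 Fedder's condition forces `J + (f)` to be closed under `p`-th roots modulo `J^[p]` -/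

section Closure

variable (p : ℕ) [Fact p.Prime] [CharP R p] [IsRegularLocalRing R]

/-- **The `p`-step.** In a regular local ring `(R, 𝔪)` of characteristic `p`, if `f^(p-1) ∉ 𝔪^[p]`
then for every ideal `J`: `y^p ∈ J^[p] + (f)` implies `y ∈ J + (f)`. Proof: with `I = J + (f)`,
`f^(p-1) y^p ∈ J^[p] + (f^p) ⊆ I^[p]`, so by Kunz `f^(p-1) ∈ (I : y)^[p]`; if `y ∉ I` then
`(I : y) ⊆ 𝔪` and `f^(p-1) ∈ 𝔪^[p]`. [cite: Fedder1983, Prop. 1.7 and proof of Thm. 1.12] -/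
theorem mem_sup_span_of_pow_mem {f : R} (hf : f ^ (p - 1) ∉ frobeniusPower p (maximalIdeal R))
    (J : Ideal R) {y : R} (hy : y ^ p ∈ frobeniusPower p J ⊔ Ideal.span {f}) :
    y ∈ J ⊔ Ideal.span {f} := by
  set I : Ideal R := J ⊔ Ideal.span {f} with hI
  by_contra hyI
  have hp0 : p ≠ 0 := (Fact.out : p.Prime).ne_zero
  obtain ⟨j, hj, g, hg, hjg⟩ := Submodule.mem_sup.mp hy
  obtain ⟨a, rfl⟩ := Ideal.mem_span_singleton'.mp hg
  have hfI : f ∈ I := Ideal.mem_sup_right (Ideal.mem_span_singleton_self f)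
  -- `f^(p-1) y^p ∈ I^[p]`
  have h1 : f ^ (p - 1) * y ^ p ∈ frobeniusPower p I := by
    rw [← hjg, mul_add]
    refine add_mem (Ideal.mul_mem_left _ _ (frobeniusPower_mono p le_sup_left hj)) ?_
    have h2 : f ^ (p - 1) * (a * f) = a * f ^ p := by
      rw [mul_left_comm, pow_sub_one_mul hp0]
    rw [h2]
    exact Ideal.mul_mem_left _ _ (pow_mem_frobeniusPower hfI)
  -- Kunz: `f^(p-1) ∈ (I : y)^[p]`
  have h3 : f ^ (p - 1) ∈ frobeniusPower p (I.colon {y}) := by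
    have h := mem_frobeniusPower_colon_of_isRegularLocalRing p (I := I) (x := y) (c := f ^ (p - 1)) 1
      (by simpa only [pow_one] using h1)
    simpa only [pow_one] using h
  have hne : I.colon {y} ≠ ⊤ := by
    intro htop
    have h1' : (1 : R) ∈ I.colon {y} := htop ▸ Submodule.mem_top
    rw [Submodule.mem_colon_singleton, one_smul] at h1'
    exact hyI h1'
  exact hf (frobeniusPower_mono p (le_maximalIdeal hne) h3)

/-- **The `p^e`-step** (induction on `e`, applying `mem_sup_span_of_pow_mem` to `J^[p^e]`): under
Fedder's condition, `y^(p^e) ∈ J^[p^e] + (f)` implies `y ∈ J + (f)`.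
[cite: Fedder1983, Prop. 1.7 and proof of Thm. 1.12] -/
theorem mem_sup_span_of_pow_pow_mem {f : R} (hf : f ^ (p - 1) ∉ frobeniusPower p (maximalIdeal R)) :
    ∀ (e : ℕ) (J : Ideal R) {y : R},
      y ^ p ^ e ∈ frobeniusPower (p ^ e) J ⊔ Ideal.span {f} → y ∈ J ⊔ Ideal.span {f} := by
  intro e
  induction e with
  | zero =>
    intro J y hy
    simpa only [pow_zero, pow_one, frobeniusPower_one] using hy
  | succ e ih =>
    intro J y hy
    refine ih J (mem_sup_span_of_pow_mem p hf (frobeniusPower (p ^ e) J) ?_)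
    have h1 : frobeniusPower p (frobeniusPower (p ^ e) J) = frobeniusPower (p ^ (e + 1)) J := by
      simpa only [pow_one] using frobeniusPower_frobeniusPower p e 1 J
    rw [← pow_mul, ← pow_succ, h1]
    exact hy

/-- **Every ideal of `R/(f)` is Frobenius closed** when `(R, 𝔪)` is regular local of characteristic
`p` and `f^(p-1) ∉ 𝔪^[p]` — stated in the inline form of route `FrobeniusLadder`
(`y^(p^e) ∈ span {z^(p^e) | z ∈ I} ⇒ y ∈ I`). Lift to `R`: the span of `p^e`-th powers of `I` is the
image of `J^[p^e]`, `J` the preimage of `I`, so a lift `y₀` of `y` has `y₀^(p^e) ∈ J^[p^e] + (f)` and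
`mem_sup_span_of_pow_pow_mem` gives `y₀ ∈ J + (f) = J`. [cite: Fedder1983, Prop. 1.7, Thm. 1.12] -/
theorem frobeniusClosed_quotient {f : R} (hf : f ^ (p - 1) ∉ frobeniusPower p (maximalIdeal R))
    (I : Ideal (R ⧸ Ideal.span {f})) (y : R ⧸ Ideal.span {f})
    (hy : ∃ e : ℕ, y ^ p ^ e ∈
      Ideal.span ((fun z : R ⧸ Ideal.span {f} => z ^ p ^ e) '' (I : Set (R ⧸ Ideal.span {f})))) :
    y ∈ I := by
  obtain ⟨e, he⟩ := hy
  set mk := Ideal.Quotient.mk (Ideal.span {f}) with hmk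
  obtain ⟨y₀, rfl⟩ := Ideal.Quotient.mk_surjective y
  set J : Ideal R := I.comap mk with hJ
  -- the span of `p^e`-th powers of `I` lies in the image of `J^[p^e]`
  have hspan : Ideal.span ((fun z : R ⧸ Ideal.span {f} => z ^ p ^ e) '' (I : Set (R ⧸ Ideal.span {f})))
      ≤ (frobeniusPower (p ^ e) J).map mk := by
    rw [Ideal.span_le]
    rintro _ ⟨z, hz, rfl⟩
    obtain ⟨z₀, rfl⟩ := Ideal.Quotient.mk_surjective z
    have hz₀ : z₀ ∈ J := Ideal.mem_comap.mpr hz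
    change mk z₀ ^ p ^ e ∈ (frobeniusPower (p ^ e) J).map mk
    rw [← map_pow]
    exact Ideal.mem_map_of_mem mk (pow_mem_frobeniusPower hz₀)
  -- pull back to `R`: `y₀^(p^e) ∈ J^[p^e] + (f)`
  have h1 : y₀ ^ p ^ e ∈ frobeniusPower (p ^ e) J ⊔ Ideal.span {f} := by
    have h2 : y₀ ^ p ^ e ∈ ((frobeniusPower (p ^ e) J).map mk).comap mk := by
      rw [Ideal.mem_comap, map_pow]
      exact hspan he
    rwa [Ideal.comap_map_of_surjective mk Ideal.Quotient.mk_surjective, ← RingHom.ker_eq_comap_bot,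
      Ideal.mk_ker] at h2
  have h3 : y₀ ∈ J ⊔ Ideal.span {f} := mem_sup_span_of_pow_pow_mem p hf e J h1
  -- `f ∈ J`, so `J + (f) = J`
  have hfJ : Ideal.span {f} ≤ J := by
    rw [Ideal.span_singleton_le_iff_mem, hJ, Ideal.mem_comap, hmk,
      Ideal.Quotient.eq_zero_iff_mem.mpr (Ideal.mem_span_singleton_self f)]
    exact I.zero_mem
  rw [sup_eq_left.mpr hfJ] at h3
  exact Ideal.mem_comap.mp h3

end Closure

/-! ## §2 The Cohen–Macaulay half: hypersurfaces in regular local rings -/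

/-- **Every system of parameters of a hypersurface ring `R/(f)` in a regular local ring is a weakly
regular sequence** (`f ∈ 𝔪`, `f ≠ 0`): `R` is Cohen–Macaulay (a regular sequence of length `dim R` in
`𝔪`, Matsumura 17.8), `f` is a non-zero-divisor (regular local rings are domains), so `R/(f)` carries a
regular sequence of length `dim R - 1 = dim R/(f)` (cutting down via Rees), and in such a ring every
system of parameters is weakly regular (Matsumura 17.4 (iii), `stub_sopWeaklyRegular`).
[cite: Matsumura1987, Thm. 17.4 (iii) and Thm. 17.8] -/
theorem sop_isWeaklyRegular_quotient [IsRegularLocalRing R] {f : R} (hfm : f ∈ maximalIdeal R)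
    (hf0 : f ≠ 0) (d : ℕ) (hd : ringKrullDim (R ⧸ Ideal.span {f}) = d)
    (s : Fin d → R ⧸ Ideal.span {f}) (hs : (Ideal.span (Set.range s)).radical.IsMaximal) :
    IsWeaklyRegular (R ⧸ Ideal.span {f}) (List.ofFn s) := by
  haveI : IsDomain R := isDomain_of_isRegularLocalRing R
  obtain ⟨_, hloc⟩ := isLocalRing_quotient_span_singleton hfm
  set mk := Ideal.Quotient.mk (Ideal.span {f}) with hmk
  have hfreg : IsSMulRegular R f :=
    (isRegular_iff_mem_nonZeroDivisors.mpr (mem_nonZeroDivisors_of_ne_zero hf0)).left.isSMulRegular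
  -- `R` is Cohen–Macaulay
  obtain ⟨rs, hrs, hmem, hlen⟩ := exists_isRegular_length_eq_ringKrullDim R
  -- cut down by `f`
  obtain ⟨rs₁, hlen₁, hmem₁, hreg₁⟩ := exists_isRegular_quotSMulTop hrs hmem hfreg hfm
  obtain ⟨hmem₂, hreg₂⟩ := isRegular_quotient_of_isRegular_quotSMulTop hfm hreg₁ hmem₁
  -- dimension bookkeeping: `dim R/(f) + 1 = dim R`
  have hdimf := ringKrullDim_quotient_span_singleton_succ_eq_ringKrullDim hfreg hfm
  have hlenR : rs.length = d + 1 := by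
    rw [hd, ← hlen] at hdimf
    exact_mod_cast hdimf.symm
  have hdim₂ : ((rs₁.map mk).length : WithBot ℕ∞) = ringKrullDim (R ⧸ Ideal.span {f}) := by
    rw [hd, List.length_map, hlen₁, hlenR, Nat.add_sub_cancel]
  exact FRationalModification.SopWeaklyRegular.stub_sopWeaklyRegular ⟨rs₁.map mk, hreg₂, hmem₂, hdim₂⟩ s
    (isSystemOfParameters_iff.mpr ⟨hd, hs⟩)

/-! ## §3 The registered helper stub -/

/-- **Fedder's criterion for hypersurfaces, sufficiency, closure form** (certification engine E2 of line
`Sketch`, crux `FInjectiveMacaulayfication`): for a regular local ring `(R, 𝔪)` of prime characteristic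
`p` and `f ∈ 𝔪` with `f^(p-1) ∉ 𝔪^[p]`, the hypersurface ring `R/(f)` has every ideal Frobenius closed
(inline form) and every system of parameters weakly regular — i.e. it satisfies the per-stalk clause of the
crux (Cohen–Macaulay + F-injective), with no F-finiteness hypothesis on `R`.
[cite: Fedder1983, Prop. 1.7 and Thm. 1.12] -/
theorem fedder_hypersurface_clause : ∀ (p : ℕ) [Fact p.Prime] (R : Type) [CommRing R] [IsRegularLocalRing R] [CharP R p] (f : R), f ∈ IsLocalRing.maximalIdeal R → f ^ (p - 1) ∉ Literature.RingTheory.TightClosure.frobeniusPower p (IsLocalRing.maximalIdeal R) → (∀ (I : Ideal (R ⧸ Ideal.span {f})) (y : R ⧸ Ideal.span {f}), (∃ e : ℕ, y ^ p ^ e ∈ Ideal.span ((fun z : R ⧸ Ideal.span {f} => z ^ p ^ e) '' (I : Set (R ⧸ Ideal.span {f})))) → y ∈ I) ∧ ∀ d : ℕ, ringKrullDim (R ⧸ Ideal.span {f}) = d → ∀ s : Fin d → R ⧸ Ideal.span {f}, (Ideal.span (Set.range s)).radical.IsMaximal → RingTheory.Sequence.IsWeaklyRegular (R ⧸ Ideal.span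 {f}) (List.ofFn s) := by
  intro p _ R _ _ _ f hfm hf
  have hp1 : 1 ≤ p - 1 := Nat.le_sub_one_of_lt (Fact.out : p.Prime).one_lt
  have hf0 : f ≠ 0 := by
    rintro rfl
    exact hf (by rw [zero_pow (by omega)]; exact zero_mem _)
  exact ⟨fun I y hy => frobeniusClosed_quotient p hf I y hy,
    fun d hd s hs => sop_isWeaklyRegular_quotient hfm hf0 d hd s hs⟩

end Summit.ResolutionOfSingularities.ResolutionOfSingularities.Theorems.FInjectiveMacaulayfication.Fedder
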